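import Literature.Analysis.PDE.SymmetricHyperbolicEnergy
import Literature.Analysis.PDE.SobolevSupBound
import Literature.Analysis.PDE.FreeFlowSlabSmooth
import HarnessLib

/-!
# A Sobolev sup bound in the currency of coordinate word derivatives (topic `Analysis/PDE`)

Analytic layer of the energy-method existence theory for linear first-order symmetric hyperbolic
systems (Friedrichs 1954), built to discharge the named fact
`Literature.Geometry.Lorentzian.KerrSchild.waveCauchyProblem`. The `ε → 0` limit of Friedrichs'
regularised solutions is taken in the sup norm of every coordinate word derivative, which
requires a Sobolev embedding `H^K ⊂ L^∞` in the currency of the word energies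
`ℰ_K(f) = Σ_{|v| ≤ K} ‖∂_v f‖₂²` of `SymmetricHyperbolicEnergy.lean`. The tree proves the
embedding (`enorm_sq_le_sobolevEnergy`, `SobolevSupBound.lean`) for *heat-admissible* fields in
the currency of the abstract-frame energies `sobolevEnergy` (`SobolevEnergy.lean`); this file is
the bridge:

* `iterDirDeriv_eq_sum_cwd` — an iterated directional derivative along arbitrary vectors is a
  finite linear combination of coordinate word derivatives (multilinearity of `Dᵏf(x)`);
* `isHeatAdmissible_of_cwd` — a smooth field all of whose coordinate word derivatives are bounded
  and square integrable is heat-admissible;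
* `sobolevEnergy_le_sum_lintegral_cwd` — `sobolevEnergy k f ≤ (n² + 1)ᵏ Σ_{|v| ≤ k} ∫ ‖∂_v f‖²`;
* `exists_norm_sq_le_wordEnergy` — **the sup bound**: there is `C` (depending on the dimension
  only) with `‖f(x)‖² ≤ C · ℰ_{2(n+1)}(f)` for every such field `f` and every `x`.

Everything is proved; no named fact and no `sorry` is introduced.

## References

* L. C. Evans, *Partial Differential Equations*, 2nd ed., AMS 2010, §5.6.3, Thm. 6 (general
  Sobolev inequalities, `H^k ⊂ C^0` for `2k > n`). [Evans2010]
* R. A. Adams, *Sobolev Spaces*, Academic Press 1975, Thm. 5.4 (C). [Adams1975]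
* K. O. Friedrichs, *Symmetric hyperbolic linear differential equations*, Comm. Pure Appl. Math.
  7 (1954) 345–392, §4 (passage to the limit). [Friedrichs1954]
-/

noncomputable section

open MeasureTheory Set Function Filter
open scoped ContDiff Topology ENNReal NNReal

namespace Literature.Analysis.PDE

open Literature.Analysis.FunctionSpaces

variable {ι : Type*} [Fintype ι] [DecidableEq ι]
variable {W : Type*} [NormedAddCommGroup W] [InnerProductSpace ℝ W]

/-! ### Directional derivatives along arbitrary vectors through coordinate words -/

section Frame

variable {F : Type*} [NormedAddCommGroup F] [NormedSpace ℝ F]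

omit [DecidableEq ι] in
/-- `∂_w g(x) = Σⱼ wⱼ ∂ⱼ g(x)` (linearity of the Fréchet derivative, `w = Σⱼ wⱼ eⱼ`). [folklore] -/
theorem fderiv_apply_eq_sum_coord (g : EuclideanSpace ℝ ι → F) (x w : EuclideanSpace ℝ ι) :
    fderiv ℝ g x w = ∑ j, w j • fderiv ℝ g x (bv j) := by
  conv_lhs => rw [← (EuclideanSpace.basisFun ι ℝ).sum_repr w]
  simp only [map_sum, map_smul, EuclideanSpace.basisFun_repr, bv_def]

omit [DecidableEq ι] in
/-- `∂_v (∂_w g) = Σⱼ wⱼ ∂_{v ++ [j]} g` for smooth `g`. [folklore] -/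
theorem cwd_fderiv_apply {g : EuclideanSpace ℝ ι → F} (hg : ContDiff ℝ ∞ g)
    (w : EuclideanSpace ℝ ι) (v : List ι) :
    cwd v (fun x ↦ fderiv ℝ g x w) = fun x ↦ ∑ j, w j • cwd (v ++ [j]) g x := by
  have h1 : (fun x ↦ fderiv ℝ g x w) = fun x ↦ ∑ j, w j • fderiv ℝ g x (bv j) :=
    funext fun x ↦ fderiv_apply_eq_sum_coord g x w
  have hsm : ∀ j, ContDiff ℝ ∞ (fun x ↦ fderiv ℝ g x (bv j)) := fun j ↦ by
    have h := contDiff_cwd hg [j]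
    rwa [show cwd [j] g = fun x ↦ fderiv ℝ g x (bv j) from cwd_append_singleton [] j g] at h
  rw [h1, cwd_finset_sum _ (fun j _ ↦ (hsm j).const_smul (w j))]
  funext x
  refine Finset.sum_congr rfl fun j _ ↦ ?_
  rw [cwd_const_smul (hsm j), cwd_append_singleton]

omit [DecidableEq ι] in
/-- **Iterated directional derivatives along arbitrary vectors through coordinate words**: for
smooth `f` and a list of directions `β = (w₁, …, w_k)`,
`∂_{w₁} ⋯ ∂_{w_k} f(x) = Σ_{σ : Fin k → ι} (Πₗ (w_l)_{σ l}) · ∂_{e_{σ 1}} ⋯ ∂_{e_{σ k}} f(x)`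
(multilinearity of `Dᵏf(x)`). [folklore] -/
theorem iterDirDeriv_eq_sum_cwd {f : EuclideanSpace ℝ ι → F} (hf : ContDiff ℝ ∞ f)
    (β : List (EuclideanSpace ℝ ι)) :
    iterDirDeriv β f = fun x ↦ ∑ σ : Fin β.length → ι,
      (∏ l, (β.get l) (σ l)) • cwd (List.ofFn σ) f x := by
  funext x
  rw [iterDirDeriv_eq_iteratedFDeriv hf β x]
  set M := iteratedFDeriv ℝ β.length f x with hM
  have hexp : (fun l ↦ β.get l) = fun l ↦ ∑ j, (β.get l) j • (bv j : EuclideanSpace ℝ ι) := by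
    funext l
    conv_lhs => rw [← (EuclideanSpace.basisFun ι ℝ).sum_repr (β.get l)]
    simp only [EuclideanSpace.basisFun_repr, bv_def]
  rw [hexp, M.map_sum (fun l j ↦ (β.get l) j • (bv j : EuclideanSpace ℝ ι))]
  refine Finset.sum_congr rfl fun σ _ ↦ ?_
  rw [M.map_smul_univ (fun l ↦ (β.get l) (σ l)) (fun l ↦ (bv (σ l) : EuclideanSpace ℝ ι)), hM,
    iteratedFDeriv_apply_eq_iterDirDeriv_ofFn hf x (fun l ↦ (bv (σ l) : EuclideanSpace ℝ ι)),
    cwd_def, List.map_ofFn]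
  rfl

end Frame

section Admissible

omit [DecidableEq ι] in
/-- **Heat-admissibility from bounds on the coordinate word derivatives**: a smooth field whose
coordinate word derivatives are all bounded and square integrable is heat-admissible (every
iterated directional derivative is a finite linear combination of them). [folklore] -/
theorem isHeatAdmissible_of_cwd [FiniteDimensional ℝ W] {f : EuclideanSpace ℝ ι → W}
    (hf : ContDiff ℝ ∞ f) (hb : ∀ u : List ι, ∃ C : ℝ, ∀ x, ‖cwd u f x‖ ≤ C)
    (hm : ∀ u : List ι, MemLp (cwd u f) 2 (volume : Measure (EuclideanSpace ℝ ι))) :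
    IsHeatAdmissible f where
  contDiff := hf
  bounded β := by
    choose C hC using hb
    refine ⟨∑ σ : Fin β.length → ι, |∏ l, (β.get l) (σ l)| * C (List.ofFn σ), fun x ↦ ?_⟩
    rw [iterDirDeriv_eq_sum_cwd hf β]
    refine (norm_sum_le _ _).trans (Finset.sum_le_sum fun σ _ ↦ ?_)
    rw [norm_smul, Real.norm_eq_abs]
    exact mul_le_mul_of_nonneg_left (hC _ x) (abs_nonneg _)
  memLp β := by
    rw [iterDirDeriv_eq_sum_cwd hf β]
    exact memLp_finsetSum _ fun σ _ ↦ (hm (List.ofFn σ)).const_smul _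

end Admissible

/-! ### The abstract-frame energies through the word integrals -/

section Bridge

omit [DecidableEq ι] in
/-- `‖Σⱼ wⱼ aⱼ‖ₑ² ≤ n Σⱼ ‖aⱼ‖ₑ²` for `‖w‖ ≤ 1` (`|wⱼ| ≤ ‖w‖`, Cauchy–Schwarz). [folklore] -/
theorem enorm_sum_smul_sq_le {w : EuclideanSpace ℝ ι} (hw : ‖w‖ ≤ 1) (a : ι → W) :
    ‖∑ j, w j • a j‖ₑ ^ 2 ≤ (Fintype.card ι : ℝ≥0∞) * ∑ j, ‖a j‖ₑ ^ 2 := by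
  have h1 : ‖∑ j, w j • a j‖ ≤ ∑ j, ‖a j‖ := by
    refine (norm_sum_le _ _).trans (Finset.sum_le_sum fun j _ ↦ ?_)
    rw [norm_smul]
    have hwj : ‖w j‖ ≤ 1 := (PiLp.norm_apply_le w j).trans hw
    calc ‖w j‖ * ‖a j‖ ≤ 1 * ‖a j‖ := mul_le_mul_of_nonneg_right hwj (norm_nonneg _)
      _ = ‖a j‖ := one_mul _
  have h2 : ‖∑ j, w j • a j‖ ^ 2 ≤ Fintype.card ι * ∑ j, ‖a j‖ ^ 2 := by
    calc ‖∑ j, w j • a j‖ ^ 2 ≤ (∑ j, ‖a j‖) ^ 2 := pow_le_pow_left₀ (norm_nonneg _) h1 2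
      _ ≤ (Finset.univ : Finset ι).card * ∑ j, ‖a j‖ ^ 2 := sq_sum_le_card_mul_sum_sq
      _ = Fintype.card ι * ∑ j, ‖a j‖ ^ 2 := by rw [Finset.card_univ]
  have hlhs : ‖∑ j, w j • a j‖ₑ ^ 2 = ENNReal.ofReal (‖∑ j, w j • a j‖ ^ 2) := by
    rw [← ofReal_norm, ENNReal.ofReal_pow (norm_nonneg _)]
  have hrhs : (Fintype.card ι : ℝ≥0∞) * ∑ j, ‖a j‖ₑ ^ 2 =
      ENNReal.ofReal (Fintype.card ι * ∑ j, ‖a j‖ ^ 2) := by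
    rw [ENNReal.ofReal_mul (Nat.cast_nonneg _), ENNReal.ofReal_natCast,
      ENNReal.ofReal_sum_of_nonneg (fun j _ ↦ sq_nonneg _)]
    congr 1
    refine Finset.sum_congr rfl fun j _ ↦ ?_
    rw [← ofReal_norm, ENNReal.ofReal_pow (norm_nonneg _)]
  rw [hlhs, hrhs]
  exact ENNReal.ofReal_le_ofReal h2

omit [DecidableEq ι] in
/-- `∫ ‖∂_v (∂_w g)‖² ≤ n Σⱼ ∫ ‖∂_{v++[j]} g‖²` for smooth `g` and `‖w‖ ≤ 1`. [folklore] -/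
theorem lintegral_cwd_fderiv_apply_sq_le {g : EuclideanSpace ℝ ι → W} (hg : ContDiff ℝ ∞ g)
    {w : EuclideanSpace ℝ ι} (hw : ‖w‖ ≤ 1) (v : List ι) :
    ∫⁻ x, ‖cwd v (fun y ↦ fderiv ℝ g y w) x‖ₑ ^ 2 ≤
      (Fintype.card ι : ℝ≥0∞) * ∑ j, ∫⁻ x, ‖cwd (v ++ [j]) g x‖ₑ ^ 2 := by
  rw [cwd_fderiv_apply hg w v]
  have hmeas : ∀ j, AEMeasurable (fun x ↦ ‖cwd (v ++ [j]) g x‖ₑ ^ 2)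
      (volume : Measure (EuclideanSpace ℝ ι)) := fun j ↦
    ((contDiff_cwd hg _).continuous.enorm.measurable.pow_const _).aemeasurable
  calc ∫⁻ x, ‖∑ j, w j • cwd (v ++ [j]) g x‖ₑ ^ 2
      ≤ ∫⁻ x, (Fintype.card ι : ℝ≥0∞) * ∑ j, ‖cwd (v ++ [j]) g x‖ₑ ^ 2 :=
        lintegral_mono fun x ↦ enorm_sum_smul_sq_le hw _
    _ = (Fintype.card ι : ℝ≥0∞) * ∑ j, ∫⁻ x, ‖cwd (v ++ [j]) g x‖ₑ ^ 2 := by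
        rw [lintegral_const_mul'' _ (Finset.aemeasurable_fun_sum _ fun j _ ↦ hmeas j),
          lintegral_finsetSum' _ fun j _ ↦ hmeas j]

/-- Reindexing: `Σ_{|v| ≤ k} Σⱼ T(v ++ [j]) ≤ Σ_{|u| ≤ k+1} T(u)` (the map `(v, j) ↦ v ++ [j]` is
injective into the words of length `≤ k + 1`). [folklore] -/
theorem sum_sum_append_singleton_le (k : ℕ) (T : List ι → ℝ≥0∞) :
    ∑ v ∈ wordsLE ι k, ∑ j, T (v ++ [j]) ≤ ∑ u ∈ wordsLE ι (k + 1), T u := by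
  classical
  set φ : List ι × ι → List ι := fun p ↦ p.1 ++ [p.2] with hφ
  have hinj : Set.InjOn φ ((wordsLE ι k) ×ˢ (Finset.univ : Finset ι) : Finset (List ι × ι)) := by
    rintro ⟨v, j⟩ - ⟨v', j'⟩ - h
    simp only [hφ] at h
    obtain ⟨h1, h2⟩ := List.append_inj' h rfl
    simp only [List.cons.injEq, and_true] at h2
    rw [h1, h2]
  have himg : ((wordsLE ι k) ×ˢ (Finset.univ : Finset ι)).image φ ⊆ wordsLE ι (k + 1) := by
    intro u hu
    obtain ⟨⟨v, j⟩, hp, rfl⟩ := Finset.mem_image.1 hu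
    have hv : v.length ≤ k := mem_wordsLE.1 (Finset.mem_product.1 hp).1
    exact mem_wordsLE.2 (by simp [hφ]; omega)
  calc ∑ v ∈ wordsLE ι k, ∑ j, T (v ++ [j])
      = ∑ p ∈ (wordsLE ι k) ×ˢ (Finset.univ : Finset ι), T (φ p) := by
        rw [Finset.sum_product]
    _ = ∑ u ∈ ((wordsLE ι k) ×ˢ (Finset.univ : Finset ι)).image φ, T u :=
        (Finset.sum_image hinj).symm
    _ ≤ ∑ u ∈ wordsLE ι (k + 1), T u := Finset.sum_le_sum_of_subset himg

/-- **The abstract-frame Sobolev energies are dominated by the word integrals**: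
`sobolevEnergy k g ≤ (n² + 1)ᵏ · Σ_{|v| ≤ k} ∫ ‖∂_v g‖²` for smooth `g` (induction on `k`: each
frame direction `bᵢ = Σⱼ (bᵢ)ⱼ eⱼ` has coordinates of modulus `≤ 1`). [folklore] -/
theorem sobolevEnergy_le_sum_lintegral_cwd (k : ℕ) {g : EuclideanSpace ℝ ι → W}
    (hg : ContDiff ℝ ∞ g) :
    sobolevEnergy k g ≤ ((Fintype.card ι : ℝ≥0∞) ^ 2 + 1) ^ k *
      ∑ v ∈ wordsLE ι k, ∫⁻ x, ‖cwd v g x‖ₑ ^ 2 := by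
  induction k generalizing g with
  | zero =>
    rw [pow_zero, one_mul, sobolevEnergy_zero_left]
    have h := Finset.single_le_sum (f := fun v : List ι ↦ ∫⁻ x, ‖cwd v g x‖ₑ ^ 2)
      (fun v _ ↦ bot_le) (nil_mem_wordsLE (ι := ι) 0)
    simpa [cwd_nil] using h
  | succ k ih =>
    set c : ℝ≥0∞ := (Fintype.card ι : ℝ≥0∞) with hc
    set S : ℝ≥0∞ := ∑ u ∈ wordsLE ι (k + 1), ∫⁻ x, ‖cwd u g x‖ₑ ^ 2 with hS
    rw [sobolevEnergy_succ]
    -- the zeroth-order term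
    have h0 : ∫⁻ x, ‖g x‖ₑ ^ 2 ≤ S := by
      have h := Finset.single_le_sum (f := fun v : List ι ↦ ∫⁻ x, ‖cwd v g x‖ₑ ^ 2)
        (fun v _ ↦ bot_le) (nil_mem_wordsLE (ι := ι) (k + 1))
      simpa [cwd_nil] using h
    -- the frame directions
    have hdir : ∀ i, sobolevEnergy k (fun x ↦ fderiv ℝ g x (stdOrthonormalBasis ℝ _ i)) ≤
        (c ^ 2 + 1) ^ k * (c * S) := by
      intro i
      have hsm : ContDiff ℝ ∞ (fun x ↦ fderiv ℝ g x (stdOrthonormalBasis ℝ _ i)) :=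
        (hg.fderiv_right (m := ∞) (by norm_cast)).clm_apply contDiff_const
      refine (ih hsm).trans (mul_le_mul_right ?_ _)
      have hw : ‖(stdOrthonormalBasis ℝ (EuclideanSpace ℝ ι) i : EuclideanSpace ℝ ι)‖ ≤ 1 :=
        ((stdOrthonormalBasis ℝ (EuclideanSpace ℝ ι)).orthonormal.norm_eq_one i).le
      calc ∑ v ∈ wordsLE ι k, ∫⁻ x, ‖cwd v (fun y ↦ fderiv ℝ g y (stdOrthonormalBasis ℝ _ i)) x‖ₑ ^ 2
          ≤ ∑ v ∈ wordsLE ι k, c * ∑ j, ∫⁻ x, ‖cwd (v ++ [j]) g x‖ₑ ^ 2 :=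
            Finset.sum_le_sum fun v _ ↦ lintegral_cwd_fderiv_apply_sq_le hg hw v
        _ = c * ∑ v ∈ wordsLE ι k, ∑ j, ∫⁻ x, ‖cwd (v ++ [j]) g x‖ₑ ^ 2 := by
            rw [Finset.mul_sum]
        _ ≤ c * S := mul_le_mul_right (sum_sum_append_singleton_le k _) _
    have hsumdir : ∑ i, sobolevEnergy k (fun x ↦ fderiv ℝ g x (stdOrthonormalBasis ℝ _ i)) ≤
        c * ((c ^ 2 + 1) ^ k * (c * S)) := by
      refine (Finset.sum_le_sum fun i _ ↦ hdir i).trans ?_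
      rw [Finset.sum_const, Finset.card_univ, nsmul_eq_mul]
      refine mul_le_mul_left ?_ _
      rw [hc, Fintype.card_fin, finrank_euclideanSpace]
    calc (∫⁻ x, ‖g x‖ₑ ^ 2) + ∑ i, sobolevEnergy k (fun x ↦ fderiv ℝ g x (stdOrthonormalBasis ℝ _ i))
        ≤ S + c * ((c ^ 2 + 1) ^ k * (c * S)) := add_le_add h0 hsumdir
      _ = (1 + c ^ 2 * (c ^ 2 + 1) ^ k) * S := by ring
      _ ≤ (c ^ 2 + 1) ^ (k + 1) * S := by
          refine mul_le_mul_left ?_ _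
          have h1 : (1 : ℝ≥0∞) ≤ (c ^ 2 + 1) ^ k := one_le_pow_of_one_le' (by simp) k
          calc 1 + c ^ 2 * (c ^ 2 + 1) ^ k ≤ (c ^ 2 + 1) ^ k + c ^ 2 * (c ^ 2 + 1) ^ k :=
                add_le_add h1 le_rfl
            _ = (c ^ 2 + 1) ^ (k + 1) := by ring

/-- `Σ_{|v| ≤ k} ∫ ‖∂_v U‖² = ofReal (ℰ_k(U))` for an `H^k`-smooth field. [folklore] -/
theorem sum_lintegral_cwd_eq_ofReal_wordEnergy {k : ℕ} {U : EuclideanSpace ℝ ι → W}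
    (hU : IsHkSmooth k U) :
    ∑ v ∈ wordsLE ι k, ∫⁻ x, ‖cwd v U x‖ₑ ^ 2 = ENNReal.ofReal (wordEnergy k U) := by
  unfold wordEnergy
  rw [ENNReal.ofReal_sum_of_nonneg (fun v _ ↦ sq_nonneg _)]
  refine Finset.sum_congr rfl fun v hv ↦ ?_
  have hmem := hU.memLp v (mem_wordsLE.1 hv)
  have h1 : ∫⁻ x, ‖cwd v U x‖ₑ ^ 2 = eLpNorm (cwd v U) 2 (volume : Measure (EuclideanSpace ℝ ι)) ^ 2 := by
    rw [eLpNorm_eq_lintegral_rpow_enorm_toReal (by norm_num) (by norm_num)]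
    simp only [ENNReal.toReal_ofNat]
    rw [← ENNReal.rpow_natCast, ← ENNReal.rpow_mul]
    norm_num
  rw [h1, eLpNorm_eq_ofReal_l2norm hmem, ← ENNReal.ofReal_pow (l2norm_nonneg _)]

end Bridge

/-! ### The sup bound -/

section Sup

variable (ι W) in
/-- **The Sobolev sup-bound constant** in the currency of word energies (depends on the
dimension `n = card ι` and the target space only). [folklore] -/
def supConst [FiniteDimensional ℝ W] : ℝ :=
  ((Classical.choose (enorm_sq_le_sobolevEnergy (E := EuclideanSpace ℝ ι) (F' := W))) *
    (((Fintype.card ι : ℝ≥0∞) ^ 2 + 1) ^ (2 * (Fintype.card ι + 1)))).toReal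

omit [DecidableEq ι] in
/-- `0 ≤ supConst`. [folklore] -/
theorem supConst_nonneg [FiniteDimensional ℝ W] : 0 ≤ supConst ι W := ENNReal.toReal_nonneg

/-- **Sobolev sup bound through word energies** (`H^K ⊂ L^∞`, `K = 2(n + 1)`): for a smooth field
all of whose coordinate word derivatives are bounded and square integrable,
`‖f(x)‖² ≤ C · ℰ_K(f)` with `C = supConst ι W`. [cite: Evans2010, §5.6.3, Thm. 6] -/
theorem norm_sq_le_supConst_mul_wordEnergy [FiniteDimensional ℝ W] {f : EuclideanSpace ℝ ι → W}
    (hf : ContDiff ℝ ∞ f) (hb : ∀ u : List ι, ∃ C : ℝ, ∀ x, ‖cwd u f x‖ ≤ C)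
    (hm : ∀ u : List ι, MemLp (cwd u f) 2 (volume : Measure (EuclideanSpace ℝ ι))) (x : EuclideanSpace ℝ ι) :
    ‖f x‖ ^ 2 ≤ supConst ι W * wordEnergy (2 * (Fintype.card ι + 1)) f := by
  set K : ℕ := 2 * (Fintype.card ι + 1) with hK
  have hspec := Classical.choose_spec (enorm_sq_le_sobolevEnergy (E := EuclideanSpace ℝ ι) (F' := W))
  set C₀ : ℝ≥0∞ := Classical.choose (enorm_sq_le_sobolevEnergy (E := EuclideanSpace ℝ ι) (F' := W))
    with hC₀
  obtain ⟨hC₀top, hle⟩ := hspec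
  have hadm : IsHeatAdmissible f := isHeatAdmissible_of_cwd hf hb hm
  have hHk : IsHkSmooth K f := ⟨hf, fun v _ ↦ hm v⟩
  have h1 := hle hadm x
  rw [finrank_euclideanSpace, ← hK] at h1
  have h2 : ‖f x‖ₑ ^ 2 ≤ C₀ * (((Fintype.card ι : ℝ≥0∞) ^ 2 + 1) ^ K) *
      ENNReal.ofReal (wordEnergy K f) := by
    refine h1.trans ?_
    rw [mul_assoc]
    refine mul_le_mul_right ?_ _
    rw [← sum_lintegral_cwd_eq_ofReal_wordEnergy hHk]
    exact sobolevEnergy_le_sum_lintegral_cwd K hf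
  have hfin : C₀ * (((Fintype.card ι : ℝ≥0∞) ^ 2 + 1) ^ K) * ENNReal.ofReal (wordEnergy K f) ≠ ⊤ :=
    ENNReal.mul_ne_top (ENNReal.mul_ne_top hC₀top (ENNReal.pow_ne_top (by simp))) ENNReal.ofReal_ne_top
  have h3 := ENNReal.toReal_mono hfin h2
  rw [← ofReal_norm, ← ENNReal.ofReal_pow (norm_nonneg _), ENNReal.toReal_ofReal (sq_nonneg _),
    ENNReal.toReal_mul, ENNReal.toReal_ofReal (wordEnergy_nonneg _ _)] at h3
  exact h3

end Sup

end Literature.Analysis.PDE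

end
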